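import Literature.Computability.MetaComplexity.EFNetlist
import Literature.Computability.MetaComplexity.EFRuleCheck
import HarnessLib

/-!
# Position-uniform inductions ("clusters") for extended Frege proof construction

Most laws of binary arithmetic inside extended Frege are proved by one induction along the bit
positions of several circuits sharing their inputs (adders, comparators, multiplexers): an
*invariant* — a fixed formula over the carries at the current position (and possibly global
parameter bits) — is established at position `0` from the carry-in definitions and propagated
by one constant-size sound rule whose premises are the invariant and the gate definitions of
the current position. This file makes the pattern generic: a `Cluster.System` consists of the
*shapes* (formulas over numbered leaves) of the position-`0` facts, of the local definitions,
the invariant, and the leaf renaming `next` (which leaf carries the next-position value of a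
state leaf); its base and step rules are generated (`System.baseRule`, `System.stepRule`), and
`System.isBlock_lines` turns availability of the instantiated shapes at every position into a
block deriving the instantiated invariant at every position. End and per-position
consequences are drawn by further generated rules (`System.endRule`,
`System.isInferredFrom_end`). Soundness of the generated rules is checked per system by
`FregeRule.checkD` (`EFRuleCheck.lean`) with the definition list `System.ds` read off the
shapes (keep the free leaves — context, state, parameters, inputs — numbered first, so that the
enumeration bound `V` of `checkD` stays small).

## Sources

* S. A. Cook, R. A. Reckhow, *The relative efficiency of propositional proof systems*,
  J. Symbolic Logic 44 (1979), §2 (sound schematic rules).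
* The invariants themselves are the reachable sets of the carry automata (folklore: a ripple
  circuit is a finite automaton reading the operand bits).
-/

namespace Literature.Computability.MetaComplexity

open _root_.Computability Complexity Complexity.PropForm Netlist

namespace Cluster

/-- A position-uniform induction system: shapes over leaves `≥ 1` (leaf `0` is the context).
[folklore] -/
structure System where
  /-- shapes of the facts available at position `0` (carry-in definitions) -/
  cins : List (PropForm ℕ)
  /-- shapes of the local definitions available at every position -/
  shapes : List (PropForm ℕ)
  /-- the invariant, over state and parameter leaves -/
  inv : PropForm ℕ
  /-- the leaf holding the next-position value of a leaf (identity on parameters) -/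
  next : ℕ → ℕ

/-- The instantiation of a shape: leaf `k` becomes the variable `act k`. [folklore] -/
def inst (act : ℕ → ℕ) (φ : PropForm ℕ) : PropForm ℕ := φ.subst fun k => var (act k)

namespace System

/-- The generated base rule: from the position-`0` facts infer the invariant.
[cite: CookReckhow1979, §2 (sound rule)] -/
def baseRule (S : System) : FregeRule := ⟨S.cins.map (ctx (var 0)), ctx (var 0) S.inv⟩

/-- The generated step rule: from the invariant and the local definitions infer the invariant
on the next-position leaves. [cite: CookReckhow1979, §2 (sound rule)] -/
def stepRule (S : System) : FregeRule :=
  ⟨ctx (var 0) S.inv :: S.shapes.map (ctx (var 0)), ctx (var 0) (inst S.next S.inv)⟩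

/-- A generated end / per-position rule: from the invariant and extra facts infer a
conclusion, all as shapes. [cite: CookReckhow1979, §2 (sound rule)] -/
def endRule (S : System) (extra : List (PropForm ℕ)) (concl : PropForm ℕ) : FregeRule :=
  ⟨ctx (var 0) S.inv :: extra.map (ctx (var 0)), ctx (var 0) concl⟩

/-- The definition list read off the shapes of the form `g ↔ body` (for `FregeRule.checkD`).
[folklore] -/
def ds (S : System) : List (ℕ × PropForm ℕ) :=
  S.shapes.filterMap fun φ => match φ with
    | conj (disj (neg (var g)) b) (disj (var g') (neg b')) => if g = g' ∧ b = b' then some (g, b) else none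
    | _ => none

/-- The side conditions on leaves: no shape uses leaf `0`, and `next` never produces leaf `0`
on the leaves of the invariant. [folklore] -/
def LeavesOK (S : System) : Prop :=
  (∀ k ∈ S.inv.vars, k ≠ 0 ∧ S.next k ≠ 0) ∧ (∀ φ ∈ S.shapes, ∀ k ∈ φ.vars, k ≠ 0) ∧
    ∀ φ ∈ S.cins, ∀ k ∈ φ.vars, k ≠ 0

/-- Boolean test that a list of shapes avoids leaf `0`. [folklore] -/
def shapesOKB (l : List (PropForm ℕ)) : Bool := l.all (allVarsB fun k => decide (k ≠ 0))

/-- `shapesOKB` is correct. [folklore] -/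
theorem forall_ne_zero_of_shapesOKB {l : List (PropForm ℕ)} (h : shapesOKB l = true) :
    ∀ φ ∈ l, ∀ k ∈ φ.vars, k ≠ 0 := fun φ hφ k hk => by
  simp only [shapesOKB, List.all_eq_true] at h
  simpa using allVarsB_eq_true (h φ hφ) k hk

/-- Boolean test of `LeavesOK`. [folklore] -/
def leavesOKB (S : System) : Bool :=
  allVarsB (fun k => decide (k ≠ 0) && decide (S.next k ≠ 0)) S.inv && shapesOKB S.shapes && shapesOKB S.cins

/-- `leavesOKB` is correct. [folklore] -/
theorem leavesOK_of_leavesOKB {S : System} (h : S.leavesOKB = true) : S.LeavesOK := by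
  simp only [leavesOKB, Bool.and_eq_true] at h
  obtain ⟨⟨h₁, h₂⟩, h₃⟩ := h
  refine ⟨fun k hk => ?_, forall_ne_zero_of_shapesOKB h₂, forall_ne_zero_of_shapesOKB h₃⟩
  have := allVarsB_eq_true h₁ k hk
  simpa using this

/-- The invariant-leaf part of `LeavesOK`, in the form used by `isInferredFrom_end`. [folklore] -/
theorem LeavesOK.inv_ne_zero {S : System} (h : S.LeavesOK) : ∀ k ∈ S.inv.vars, k ≠ 0 := fun k hk => (h.1 k hk).1

/-- The invariant line at position `i` under the leaf assignment `act`. [folklore] -/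
def line (S : System) (K : PropForm ℕ) (act : ℕ → ℕ → ℕ) (i : ℕ) : PropForm ℕ := ctx K (inst (act i) S.inv)

/-- The invariant lines at positions `0 … W`. [folklore] -/
def lines (S : System) (K : PropForm ℕ) (act : ℕ → ℕ → ℕ) (W : ℕ) : List (PropForm ℕ) :=
  (List.range (W + 1)).map (S.line K act)

/-- The substitution used at a position: the context for leaf `0`, the variables `act k`
otherwise. [folklore] -/
def posSub (K : PropForm ℕ) (act : ℕ → ℕ) (k : ℕ) : PropForm ℕ := if k = 0 then K else var (act k)

/-- Matching a contextualised shape: substituting `posSub` into `var 0 ∨ φ` gives `K ∨ φ[act]`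
when `φ` does not use leaf `0`. [folklore] -/
theorem subst_ctx_shape (K : PropForm ℕ) (act : ℕ → ℕ) {φ : PropForm ℕ} (hφ : ∀ k ∈ φ.vars, k ≠ 0) :
    (ctx (var 0) φ).subst (posSub K act) = ctx K (inst act φ) := by
  simp only [ctx, subst, posSub, inst]
  congr 1
  exact subst_congr fun k hk => if_neg (hφ k hk)

variable {G : FregeSystem} {Γ : Set (PropForm ℕ)} {S : System}

/-- **The generic induction.** If the base and step rules of `S` are rules of `G`, the leaf
assignment is coherent (`act (i+1) k = act i (next k)` on the leaves of the invariant), the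
position-`0` facts and the local definitions are available at every position `< W`, then the
invariant lines at positions `0 … W` form a block. [cite: CookReckhow1979, §2] -/
theorem isBlock_lines (hok : S.LeavesOK) (hbase : S.baseRule ∈ G.rules) (hstep : S.stepRule ∈ G.rules)
    (K : PropForm ℕ) (act : ℕ → ℕ → ℕ) (W : ℕ)
    (hcoh : ∀ i < W, ∀ k ∈ S.inv.vars, act (i + 1) k = act i (S.next k))
    (hcins : ∀ φ ∈ S.cins, ctx K (inst (act 0) φ) ∈ Γ)
    (havail : ∀ i < W, ∀ φ ∈ S.shapes, ctx K (inst (act i) φ) ∈ Γ) :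
    G.IsBlock Γ (S.lines K act W) := by
  obtain ⟨hinv, hsh, hci⟩ := hok
  refine isBlock_map_range (W + 1) fun i hi => Or.inr ?_
  rcases i with _ | i
  · refine FregeSystem.IsInferredFrom.of_rule hbase (posSub K (act 0))
      (subst_ctx_shape K (act 0) fun k hk => (hinv k hk).1) ?_
    intro p hp
    obtain ⟨φ, hφ, rfl⟩ := List.mem_map.1 hp
    rw [subst_ctx_shape K (act 0) (hci φ hφ)]
    exact Or.inl (hcins φ hφ)
  · have hiW : i < W := by omega
    refine FregeSystem.IsInferredFrom.of_rule hstep (posSub K (act i)) ?_ ?_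
    · -- the conclusion is the invariant at `i + 1`
      have h0 : ∀ k ∈ (inst S.next S.inv).vars, k ≠ 0 := by
        intro k hk
        rw [inst, mem_vars_subst] at hk
        obtain ⟨k', hk', hkk'⟩ := hk
        simp only [vars, Finset.mem_singleton] at hkk'
        rw [hkk']
        exact (hinv k' hk').2
      rw [stepRule, subst_ctx_shape K (act i) h0]
      simp only [line, inst, subst_subst]
      congr 1
      exact subst_congr fun k hk => by simp only [subst, hcoh i hiW k hk]
    · intro p hp
      rcases List.mem_cons.1 hp with rfl | hp
      · rw [subst_ctx_shape K (act i) fun k hk => (hinv k hk).1]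
        exact Or.inr ⟨i, Nat.lt_succ_self i, rfl⟩
      · obtain ⟨φ, hφ, rfl⟩ := List.mem_map.1 hp
        rw [subst_ctx_shape K (act i) (hsh φ hφ)]
        exact Or.inl (havail i hiW φ hφ)

/-- The invariant line at `i ≤ W` is in the block. [folklore] -/
theorem mem_lines (S : System) (K : PropForm ℕ) (act : ℕ → ℕ → ℕ) {W i : ℕ} (hi : i ≤ W) :
    S.line K act i ∈ S.lines K act W :=
  mem_map_range (line := S.line K act) (by omega)

/-- Size of the invariant lines. [folklore] -/
theorem proofSize_lines (S : System) (K : PropForm ℕ) (act : ℕ → ℕ → ℕ) (W : ℕ) :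
    proofSize (S.lines K act W) ≤ (W + 1) * (K.size + S.inv.size + 1) :=
  proofSize_map_range_le fun i _ => by
    have := size_subst_le (τ := fun k => var (act i k)) (M := 1) le_rfl (fun _ => le_rfl) S.inv
    simp only [line, ctx, size, inst]
    omega

/-- **Drawing a conclusion from the invariant** (end of the induction, or at any position): if
`S.endRule extra concl` is a rule of `G`, the invariant line at `i` and the extra facts
(instantiated shapes) are available, then `K ∨ concl[act i]` is inferred (only the leaves of
the invariant need to avoid `0`, cf. `LeavesOK.1`). [cite: CookReckhow1979, §2] -/
theorem isInferredFrom_end (hinv : ∀ k ∈ S.inv.vars, k ≠ 0) {extra : List (PropForm ℕ)} {concl : PropForm ℕ}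
    (hr : S.endRule extra concl ∈ G.rules) (hex : ∀ φ ∈ extra, ∀ k ∈ φ.vars, k ≠ 0)
    (hc : ∀ k ∈ concl.vars, k ≠ 0) (K : PropForm ℕ) (act : ℕ → ℕ → ℕ) (i : ℕ) {T : Set (PropForm ℕ)}
    (hline : S.line K act i ∈ T) (hextra : ∀ φ ∈ extra, ctx K (inst (act i) φ) ∈ T) :
    G.IsInferredFrom T (ctx K (inst (act i) concl)) := by
  refine FregeSystem.IsInferredFrom.of_rule hr (posSub K (act i)) (subst_ctx_shape K (act i) hc) ?_
  intro p hp
  rcases List.mem_cons.1 hp with rfl | hp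
  · rw [subst_ctx_shape K (act i) hinv]
    exact hline
  · obtain ⟨φ, hφ, rfl⟩ := List.mem_map.1 hp
    rw [subst_ctx_shape K (act i) (hex φ hφ)]
    exact hextra φ hφ

end System

end Cluster

end Literature.Computability.MetaComplexity
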